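import Literature.NumberTheory.LFunctions.RHWave0
import Literature.NumberTheory.LFunctions.MertensConjectureDisproofProofs
import Literature.NumberTheory.LFunctions.MertensCertificate.Chunk00
import Literature.NumberTheory.LFunctions.MertensCertificate.Chunk01
import Literature.NumberTheory.LFunctions.MertensCertificate.Chunk02
import Literature.NumberTheory.LFunctions.MertensCertificate.Chunk03
import Literature.NumberTheory.LFunctions.MertensCertificate.Chunk04
import Literature.NumberTheory.LFunctions.MertensCertificate.Chunk05
import Literature.NumberTheory.LFunctions.MertensCertificate.Chunk06
import Literature.NumberTheory.LFunctions.MertensCertificate.Chunk07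
import Literature.NumberTheory.LFunctions.MertensCertificate.Chunk08
import Literature.NumberTheory.LFunctions.MertensCertificate.Chunk09
import Literature.NumberTheory.LFunctions.MertensCertificate.Chunk10
import Literature.NumberTheory.LFunctions.MertensCertificate.Chunk11
import Literature.NumberTheory.LFunctions.MertensCertificate.Chunk12
import Literature.NumberTheory.LFunctions.MertensCertificate.Chunk13
import Literature.NumberTheory.LFunctions.MertensCertificate.Chunk14
import Literature.NumberTheory.LFunctions.MertensCertificate.Chunk15
import Literature.NumberTheory.LFunctions.MertensCertificate.Chunk16
import Literature.NumberTheory.LFunctions.MertensCertificate.Chunk17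
import Literature.NumberTheory.LFunctions.MertensCertificate.Chunk18
import Literature.NumberTheory.LFunctions.MertensCertificate.Chunk19
import Literature.NumberTheory.LFunctions.MertensCertificate.Top
import HarnessLib

/-!
# RH family, wave 0 — proofs: the Odlyzko–te Riele disproof of the Mertens conjecture (rh.S22), assembled

Topic: `Literature/NumberTheory/LFunctions`. Sibling proof file of `RHWave0.lean` discharging its
three `rh.S22` named facts

* `Literature.NumberTheory.LFunctions.odlyzko_te_riele_limsup` (`limsup M(x) x^{-1/2} > 1.06`),
* `Literature.NumberTheory.LFunctions.odlyzko_te_riele_liminf` (`liminf M(x) x^{-1/2} < -1.009`),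
* `Literature.NumberTheory.LFunctions.not_mertens_conjecture` (`|M(x)| < √x` for all `x > 1` is false),

i.e. A. M. Odlyzko, H. J. J. te Riele, *Disproof of the Mertens conjecture*, J. reine angew. Math.
**357** (1985) 138–160 [OdlyzkoTeRiele1985]: the display of §1, p. 139, and "Consequently, the
Mertens conjecture is false", p. 155. This file only chains results already in the tree:

1. the architecture of the printed proof (`MertensConjectureDisproof.lean`): kernel theorem
   (p. 144) + admissibility of the Jurkat–Peyerimhoff kernel ((4.1), p. 150) + the numerics of
   §4.2–4.3 (Table 3, lines 15 and 21, p. 155) ⟹ rh.S22 (`not_mertens_conjecture_of_facts`, …);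
2. the discharges of the two analytic facts (`MertensConjectureDisproofProofs.lean`:
   `OdlyzkoTeRiele1985_kernelTheorem_holds` — Ingham 1942 / Jurkat–Peyerimhoff, via the in-tree
   Ingham smoothing theorem — and `jurkatPeyerimhoffKernel_admissible_holds`), leaving
   `not_mertens_conjecture_of_numerics : OdlyzkoTeRiele1985_numerics → not_mertens_conjecture`;
3. the certified recomputation of the numerics (`MertensCertificate.lean`, soundness theorem
   `ZetaNumerics.Mertens.numerics_of_checks`): 2000 zero brackets of width `2⁻²⁴⁰` certified by
   twisted sign tests with 90-digit Euler–Maclaurin evaluations of `ζ`, enclosures of the summands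
   `2 Re [k(γ) e^{iγy} / (ρ ζ'(ρ))]` at the two `y` of Table 3, the zero count `N(2516) = 2000`
   from a winding certificate along `[½, 2] × {2516}` (so that *every* zero with `|γ| < 2516` is
   one of the 2000 bracketed simple zeros on the line — the hypothesis the paper takes from the RH
   verifications it cites on p. 139), and the final comparisons `h_K(y₊) > 1.06`,
   `h_K(y₋) < -1.009`; evaluated block by block in `MertensCertificate/Chunk00.lean` …
   `Chunk19.lean` and `MertensCertificate/Top.lean` (one `native_decide` each).

## Axioms

`OdlyzkoTeRiele1985_numerics_holds` and the three `rh.S22` discharges below depend on `propext`,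
`Classical.choice`, `Quot.sound` and on the 22 `native_decide` auxiliary axioms of
`MertensCertificate.ZetaNumerics.Mertens.checkChunk_00` … `checkChunk_19`, `checkTop_holds`,
`checkFinal_holds` (trust in the Lean compiler, the `Lean.ofReduceBool` / `Lean.trustCompiler`
family) — exactly as the printed proof is a machine computation (§4.2–4.4, pp. 151–157: 2000 zeros
to 100 digits on a CDC Cyber 750, lattice basis reduction on a Cray-1). Proposal flag
`computational`. Everything else in the chain is proved from the standard axioms.

## Contents (namespace `Literature.NumberTheory.LFunctions`)

* `OdlyzkoTeRiele1985_numerics_holds : OdlyzkoTeRiele1985_numerics`;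
* `odlyzko_te_riele_limsup_holds`, `odlyzko_te_riele_liminf_holds` (rh.S22, both sides);
* `not_mertens_conjecture_holds : not_mertens_conjecture` (rh.S22).

## References

* [OdlyzkoTeRiele1985] A. M. Odlyzko, H. J. J. te Riele, *Disproof of the Mertens conjecture*,
  J. reine angew. Math. 357 (1985), 138–160 — §1 p. 139 (statement), §2 Theorem p. 144,
  §4.1 (4.1) p. 150, §4.3 Table 3 p. 155.
-/

noncomputable section

namespace Literature.NumberTheory.LFunctions

open MertensCertificate.ZetaNumerics.Mertens in
/-- **Discharge of `OdlyzkoTeRiele1985_numerics`** (the numerical content of the disproof,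
§4.2–4.3 and Table 3, lines 15 and 21, p. 155, with `T₀ = 2516 ∈ (γ₂₀₀₀, γ₂₀₀₁)` in place of
`T = γ₂₀₀₀`, as allowed by the existential statement of the fact): the soundness theorem
`ZetaNumerics.Mertens.numerics_of_checks` of the certified computation applied to the 22 compiled
block evaluations `checkChunk_00` … `checkChunk_19`, `checkTop_holds`, `checkFinal_holds`.
[cite: OdlyzkoTeRiele1985, §4.3 Table 3 (lines 15, 21) p. 155, with (4.1) p. 150 and p. 139] -/
theorem OdlyzkoTeRiele1985_numerics_holds : OdlyzkoTeRiele1985_numerics := by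
  refine ZetaNumerics.Mertens.numerics_of_checks checkTop_holds checkFinal_holds fun k hk => ?_
  have hk20 : k < 20 := hk
  interval_cases k
  · exact checkChunk_00
  · exact checkChunk_01
  · exact checkChunk_02
  · exact checkChunk_03
  · exact checkChunk_04
  · exact checkChunk_05
  · exact checkChunk_06
  · exact checkChunk_07
  · exact checkChunk_08
  · exact checkChunk_09
  · exact checkChunk_10
  · exact checkChunk_11
  · exact checkChunk_12
  · exact checkChunk_13
  · exact checkChunk_14
  · exact checkChunk_15
  · exact checkChunk_16
  · exact checkChunk_17
  · exact checkChunk_18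
  · exact checkChunk_19

/-- **rh.S22, positive side, discharged**: `limsup_{x→∞} M(x) x^{-1/2} > 1.06`, in the tree's
phrasing "there is `a > 1.06` with `M(x) > a√x` for arbitrarily large `x`" (Odlyzko–te Riele 1985,
the display of §1, p. 139; p. 155, Table 3 line 15). [cite: OdlyzkoTeRiele1985, §1 p. 139 and §4.3 p. 155] -/
theorem odlyzko_te_riele_limsup_holds : odlyzko_te_riele_limsup :=
  odlyzko_te_riele_limsup_of_numerics OdlyzkoTeRiele1985_numerics_holds

/-- **rh.S22, negative side, discharged**: `liminf_{x→∞} M(x) x^{-1/2} < -1.009`, i.e. "there is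
`a < -1.009` with `M(x) < a√x` for arbitrarily large `x`" (Odlyzko–te Riele 1985, §1, p. 139;
p. 155, Table 3 line 21). [cite: OdlyzkoTeRiele1985, §1 p. 139 and §4.3 p. 155] -/
theorem odlyzko_te_riele_liminf_holds : odlyzko_te_riele_liminf :=
  odlyzko_te_riele_liminf_of_numerics OdlyzkoTeRiele1985_numerics_holds

/-- **rh.S22 discharged: the Mertens conjecture is false** — it is not the case that
`|M(x)| < √x` for every real `x > 1` (Odlyzko–te Riele 1985, (1.3) p. 139 and p. 155:
"Consequently, the Mertens conjecture is false"). No counterexample `x` is exhibited, here as in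
print: the proof goes through `limsup M(x) x^{-1/2} > 1.06`. [cite: OdlyzkoTeRiele1985, §1 (1.3) p. 139 and §4.3 p. 155] -/
theorem not_mertens_conjecture_holds : not_mertens_conjecture :=
  not_mertens_conjecture_of_numerics OdlyzkoTeRiele1985_numerics_holds

end Literature.NumberTheory.LFunctions

end
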